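import Summits.Ventures.LatticeQCDFlow.Scaling.TaggedPerStepGain

/-!
HONEST FRAMING: exact (Metropolis-corrected) sampling algorithms for lattice gauge theory; figures
of merit are autocorrelation/cost numbers at stated couplings and volumes; no continuum-physics
claim.

# TaggedCertificateLedger — THE PER-ATTEMPT CERTIFICATE OF AN ADJACENT PAIR, EXACTLY: `Q_j = s3_j + 2c^X_j + L·gap_{a,j} + gaps^θ_j − (1−θ_ζ)e_j − L·e_j⁺`, THE ★-CERTIFICATE WITH
# ITS SLACK KEPT (`Σ_{j≤J} c^X_j = (1−θ_a)x_J(★) + Σ_{j<J}⟨x_j, slack⟩`, `s1 = (1−σ)·slack(ζ) + σ·E_x̃[slack] + (1−σ)(1−θ_a)x̃(★)` EXACTLY), HENCE THE CUMULATIVE AND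
# DISCOUNTED CERTIFICATES AS «NON-NEGATIVE INCOMES MINUS (L + 1 − θ_ζ)·DEFICIT» (lean-2 GEN-41, ours)

Venture-side (OURS).  Cell `lqcd-flow` (pub-lqcd), unit `pub-lqcd-lean-2-g41`, 2026-08-30.  Chapter AA (route (β), the cost side), file 4.  Setting of W14∕W15∕Z4∕Z8: the two tagged hub
chains `P_X` (tag `a`), `P_Y` (tag `b`, `W_b ≤ W_a`) on `Option S` over a common ordinary composition `N_C` (`Σ N_C = K`), `j`-attempt laws `x_j`, `y_j` from an ordinary hub `z`, costs
`cost(u) = Σ_v u(v)(1−θ_v) + u(★)(1−θ_tag)`, `θ`-masses `M_X = M_C + θ_a`, `M_Y = M_C + θ_b`, `L = 2K + M_X + M_Y`.  MEMO-gen40 §4 reduced OPEN-MATH (b′) to the sign of the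
`σ`-weighted sum of the per-attempt certificates `Q_j = L·G_j − cost(x_j) − cost(y_j)`, `G_j = x_j(★) + (x_j(a) − y_j(a)) − 𝟙{z∉{a,b}}(y_j(z) − x_j(z))⁺` (Z8).  This file is the
exact bookkeeping behind that sum (no inequality is lost):

* §1 (generic, any kernel∕reward∕potential) **`ledger_step_eq`**: `E_{J_{j+1}}[r] = ⟨J_j, slack⟩ + E_{J_j}[Λ] − E_{J_{j+1}}[Λ]`, `slack(t) = Σ_{t'}P(t,t')(r+Λ)(t') − Λ(t)`;
  **`ledger_cumulative_eq`**: `Σ_{j<n}E_{J_{j+1}}[r] = Σ_{j<n}⟨J_j,slack⟩ + E_{J_0}Λ − E_{J_n}Λ`; **`ledger_tail_eq`**: for a tail resolvent `ũ = (1−σ)P(z,·) + σũP`,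
  `E_ũ[r] = (1−σ)slack(z) + σE_ũ[slack] + (1−σ)(Λ(z) − E_ũΛ)` — W14's two super-solution principles with the slack KEPT; `ledger_tail_ge`: `E_ũ[slack] ≥ (1−σ)⟨P(z,·),slack⟩`
  when `slack ≥ 0` on the support.
* §2 **`ledger_perStep_eq` (pure algebra):** `L·(x★ + gap_a − 𝟙·e⁺) − cost(x) − cost(y) = [(1+θ_b−2θ_a)x★ − (1−θ_b)y★] + 2[(K+M_X)x★ − cost(x)] + L·gap_a + Σ_{w≠z}(x(w)−y(w))(1−θ_w)
  − (1−θ_z)(y(z)−x(z)) − L·𝟙·e⁺` for ANY two laws `x, y` on `Option S` (the `Y`-cost is the `X`-cost corrected by the tag terms, the gaps off `z` and the start-content difference).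
* §3 **`ledger_certX_cumulative`**: for the tagged chain `P_X` from `z` (every content present): `Σ_{j<n}c^X_{j+1} = (1−θ_a)x_n(★) + Σ_{j<n}⟨x_j, slack_X⟩` with `slack_X ≥ 0` (W14
  `tagged_supersolution`), and **`ledger_certX_tail`**: `s1 := (K+M_X)x̃(★) − cost(x̃) = (1−σ)slack_X(z) + σE_x̃[slack_X] + (1−σ)(1−θ_a)x̃(★) ≥ (1−σ)[slack_X(z) + σ⟨P_X(z,·),slack_X⟩]`.

So (memo MEMO-gen41 §2): `S_J = Σ_{j≤J}Q_j = 2(1−θ_a)x_J(★) + Σ_j[2⟨x_{j−1},slack_X⟩ + s3_j + L·gap_{a,j} + gaps^θ_j + (1−θ_z)e_j⁻] − (L+1−θ_z)Σ_j e_j⁺`, every income non-negative where Z4 (gaps),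
W21-per-step (`s3_j`, regime `W_a ≥ W_b ≥ W_z`) apply; the discounted form pays `L·D` out of `2s1 ≥ 2(1−σ)[slack_X(z) + σ⟨P_X(z,·),slack_X⟩]`, against the explicit budgets of files 1–3.
Literature grade (cell rule): OWN, bookkeeping; nothing cited; no new bib keys.
-/

open Finset

namespace Summit.Ventures.LatticeQCDFlow.Scaling

/-! ### §1 Super-solution principles with the slack kept (generic) -/
section LedgerGeneric
variable {T : Type*} [Fintype T]

/-- **One step:** `E_{J_{j+1}}[r] = ⟨J_j, slack⟩ + E_{J_j}Λ − E_{J_{j+1}}Λ`. [ours] -/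
theorem ledger_step_eq {P : T → T → ℝ} {r Λ sl : T → ℝ} (hsl : ∀ s, sl s = ∑ t, P s t * (r t + Λ t) - Λ s) {Jt : ℕ → T → ℝ}
    (hJS : ∀ j t, Jt (j + 1) t = ∑ s, Jt j s * P s t) (j : ℕ) :
    ∑ t, Jt (j + 1) t * r t = ∑ s, Jt j s * sl s + ∑ s, Jt j s * Λ s - ∑ t, Jt (j + 1) t * Λ t := by
  have e1 : ∑ s, Jt j s * sl s = ∑ s, Jt j s * ∑ t, P s t * (r t + Λ t) - ∑ s, Jt j s * Λ s := by
    rw [← sum_sub_distrib]; exact sum_congr rfl fun s _ => by rw [hsl]; ring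
  have e2 : ∑ s, Jt j s * ∑ t, P s t * (r t + Λ t) = ∑ t, Jt (j + 1) t * r t + ∑ t, Jt (j + 1) t * Λ t := by
    calc ∑ s, Jt j s * ∑ t, P s t * (r t + Λ t) = ∑ t, (∑ s, Jt j s * P s t) * (r t + Λ t) := by
          simp_rw [mul_sum, sum_mul]; rw [sum_comm]; exact sum_congr rfl fun t _ => sum_congr rfl fun s _ => by ring
      _ = ∑ t, Jt (j + 1) t * r t + ∑ t, Jt (j + 1) t * Λ t := by
          rw [← sum_add_distrib]; exact sum_congr rfl fun t _ => by rw [← hJS j t]; ring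
  linarith

/-- **Cumulative:** `Σ_{j<n}E_{J_{j+1}}[r] = Σ_{j<n}⟨J_j, slack⟩ + E_{J_0}Λ − E_{J_n}Λ`. [ours] -/
theorem ledger_cumulative_eq {P : T → T → ℝ} {r Λ sl : T → ℝ} (hsl : ∀ s, sl s = ∑ t, P s t * (r t + Λ t) - Λ s) {Jt : ℕ → T → ℝ}
    (hJS : ∀ j t, Jt (j + 1) t = ∑ s, Jt j s * P s t) (n : ℕ) :
    ∑ j ∈ range n, ∑ t, Jt (j + 1) t * r t = ∑ j ∈ range n, ∑ s, Jt j s * sl s + (∑ t, Jt 0 t * Λ t - ∑ t, Jt n t * Λ t) := by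
  induction n with
  | zero => simp
  | succ n ih => rw [sum_range_succ, sum_range_succ, ih, ledger_step_eq hsl hJS n]; ring

/-- **Tail resolvent:** `ũ = (1−σ)P(z,·) + σũP` ⇒ `E_ũ[r] = (1−σ)slack(z) + σE_ũ[slack] + (1−σ)(Λ(z) − E_ũΛ)`. [ours] -/
theorem ledger_tail_eq {P : T → T → ℝ} {r Λ sl ut : T → ℝ} {σ : ℝ} {z : T} (hsl : ∀ s, sl s = ∑ t, P s t * (r t + Λ t) - Λ s)
    (hut : ∀ t, ut t = (1 - σ) * P z t + σ * ∑ s, ut s * P s t) :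
    ∑ t, ut t * r t = (1 - σ) * sl z + σ * ∑ s, ut s * sl s + (1 - σ) * (Λ z - ∑ t, ut t * Λ t) := by
  have expand : ∑ t, ut t * (r t + Λ t) = (1 - σ) * ∑ t, P z t * (r t + Λ t) + σ * ∑ s, ut s * ∑ t, P s t * (r t + Λ t) := by
    calc ∑ t, ut t * (r t + Λ t) = ∑ t, ((1 - σ) * P z t + σ * ∑ s, ut s * P s t) * (r t + Λ t) :=
          sum_congr rfl fun t _ => by rw [hut t]
      _ = ∑ t, ((1 - σ) * (P z t * (r t + Λ t)) + σ * ∑ s, ut s * P s t * (r t + Λ t)) :=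
          sum_congr rfl fun t _ => by rw [add_mul, mul_assoc, mul_assoc, sum_mul]
      _ = (1 - σ) * ∑ t, P z t * (r t + Λ t) + σ * ∑ t, ∑ s, ut s * P s t * (r t + Λ t) := by
          rw [sum_add_distrib, ← mul_sum, ← mul_sum]
      _ = (1 - σ) * ∑ t, P z t * (r t + Λ t) + σ * ∑ s, ∑ t, ut s * P s t * (r t + Λ t) := by rw [sum_comm]
      _ = (1 - σ) * ∑ t, P z t * (r t + Λ t) + σ * ∑ s, ut s * ∑ t, P s t * (r t + Λ t) := by
          congr 1; congr 1; refine sum_congr rfl fun s _ => ?_; rw [mul_sum]; exact sum_congr rfl fun t _ => by ring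
  have e : ∑ t, ut t * (r t + Λ t) = ∑ t, ut t * r t + ∑ t, ut t * Λ t := by rw [← sum_add_distrib]; exact sum_congr rfl fun t _ => by ring
  have hz : sl z = ∑ t, P z t * (r t + Λ t) - Λ z := hsl z
  have hE : ∑ s, ut s * sl s = ∑ s, ut s * ∑ t, P s t * (r t + Λ t) - ∑ s, ut s * Λ s := by
    rw [← sum_sub_distrib]; exact sum_congr rfl fun s _ => by rw [hsl]; ring
  rw [hz, hE]
  linarith [expand, e]

/-- `E_ũ[slack] ≥ (1−σ)·⟨P(z,·), slack⟩` when `slack ≥ 0` wherever `ũ` or `P(z,·)` can put mass (here: `slack ≥ 0` everywhere `ũ − (1−σ)P(z,·) ≥ 0` is used through `ũP ≥ 0`). [ours] -/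
theorem ledger_tail_ge {P : T → T → ℝ} {sl ut : T → ℝ} {σ : ℝ} {z : T} (hσ0 : 0 ≤ σ) (hP0 : ∀ s t, 0 ≤ P s t) (hut0 : ∀ t, 0 ≤ ut t)
    (hsl0 : ∀ t, 0 ≤ sl t) (hut : ∀ t, ut t = (1 - σ) * P z t + σ * ∑ s, ut s * P s t) :
    (1 - σ) * ∑ t, P z t * sl t ≤ ∑ t, ut t * sl t := by
  rw [mul_sum]
  refine sum_le_sum fun t _ => ?_
  rw [hut t, ← mul_assoc]
  have : 0 ≤ σ * ∑ s, ut s * P s t := mul_nonneg hσ0 (sum_nonneg fun s _ => mul_nonneg (hut0 s) (hP0 s t))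
  nlinarith [hsl0 t]

end LedgerGeneric

/-! ### §2 The per-attempt certificate decomposed (pure algebra) -/
section LedgerStep
variable {S : Type*} [Fintype S] [DecidableEq S]

/-- **`Q = s3 + 2c^X + L·gap_a + gaps^θ − (1−θ_z)e − L·𝟙·e⁺`** for any two laws `x, y` on `Option S`: with `cost_X = Σ_v x(v)(1−θ_v) + x(★)(1−θ_a)`,
`cost_Y = Σ_v y(v)(1−θ_v) + y(★)(1−θ_b)`, `L = 2K + M_X + M_Y`, `M_Y − M_X = θ_b − θ_a`. [ours] -/
theorem ledger_perStep_eq {θ : S → ℝ} {θa θb K MX MY L pen : ℝ} {x y : Option S → ℝ} {z a : S}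
    (hM : MY = MX + (θb - θa)) (hL : L = 2 * K + MX + MY) :
    L * (x none + (x (some a) - y (some a)) - pen) - (∑ v, x (some v) * (1 - θ v) + x none * (1 - θa)) - (∑ v, y (some v) * (1 - θ v) + y none * (1 - θb))
      = ((1 + θb - 2 * θa) * x none - (1 - θb) * y none)
        + 2 * ((K + MX) * x none - (∑ v, x (some v) * (1 - θ v) + x none * (1 - θa)))
        + L * (x (some a) - y (some a))
        + ∑ v ∈ univ.erase z, (x (some v) - y (some v)) * (1 - θ v)
        - (1 - θ z) * (y (some z) - x (some z))
        - L * pen := by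
  have hz : z ∈ (univ : Finset S) := mem_univ z
  have ex : ∑ v, x (some v) * (1 - θ v) = x (some z) * (1 - θ z) + ∑ v ∈ univ.erase z, x (some v) * (1 - θ v) := (add_sum_erase _ _ hz).symm
  have ey : ∑ v, y (some v) * (1 - θ v) = y (some z) * (1 - θ z) + ∑ v ∈ univ.erase z, y (some v) * (1 - θ v) := (add_sum_erase _ _ hz).symm
  have eg : ∑ v ∈ univ.erase z, (x (some v) - y (some v)) * (1 - θ v) = ∑ v ∈ univ.erase z, x (some v) * (1 - θ v) - ∑ v ∈ univ.erase z, y (some v) * (1 - θ v) := by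
    rw [← sum_sub_distrib]; exact sum_congr rfl fun v _ => by ring
  rw [ex, ey, eg, hL, hM]
  ring

end LedgerStep

/-! ### §3 The ★-certificate of `X` with its slack -/
section LedgerCert
variable {S : Type*} [Fintype S] [DecidableEq S]
variable {W θ : S → ℝ} {acc : S → S → ℝ} {p : ℝ} {K : ℕ} {NC : S → ℕ} {s : S} {P : Option S → Option S → ℝ}

/-- **`Σ_{j<n} c^X_{j+1} = (1−θ_s)J_n(★) + Σ_{j<n}⟨J_j, slack⟩` with `slack ≥ 0`** for the tagged hub chain from an ordinary hub (`c^X_j = (K+M)J_j(★) − cost(J_j)`; every content present). [ours] -/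
theorem ledger_certX_cumulative (hW : ∀ v, 0 < W v) (hp0 : 0 ≤ p) (hp : ∀ v, p * W v ≤ 1) (hθ : ∀ v, θ v = 1 / (1 + p * W v))
    (hacc : ∀ h v, acc h v = min 1 (W h / W v))
    (hPoff : ∀ h v, h ≠ v → P (some h) (some v) = if NC h = 0 then 0 else (NC v : ℝ) / K * acc h v)
    (hPin : ∀ h, P (some h) none = if NC h = 0 then 0 else acc h s / K)
    (hPdiag : ∀ h, P (some h) (some h) = 1 - (∑ v ∈ univ.erase h, P (some h) (some v) + P (some h) none))
    (hPout : ∀ v, P none (some v) = (NC v : ℝ) / K * acc s v) (hPstay : P none none = 1 - ∑ v, P none (some v))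
    (hK : 1 ≤ K) (hNC : ∑ v, NC v = K) (hpres : ∀ v, NC v ≠ 0) {M : ℝ} (hM : M = ∑ v, θ v * (NC v : ℝ) + θ s)
    {r Λ sl : Option S → ℝ} (hrn : r none = (K + M) - (1 - θ s)) (hrs : ∀ v, r (some v) = -(1 - θ v))
    (hΛn : Λ none = -(1 - θ s)) (hΛs : ∀ v, Λ (some v) = 0) (hsl : ∀ t, sl t = ∑ t', P t t' * (r t' + Λ t') - Λ t)
    {z : S} {Jt : ℕ → Option S → ℝ} (hJ0 : ∀ t, Jt 0 t = if t = some z then 1 else 0) (hJS : ∀ j t, Jt (j + 1) t = ∑ t', Jt j t' * P t' t) (n : ℕ) :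
    (∑ j ∈ range n, ((K + M) * Jt (j + 1) none - (∑ v, Jt (j + 1) (some v) * (1 - θ v) + Jt (j + 1) none * (1 - θ s)))
        = (1 - θ s) * Jt n none + ∑ j ∈ range n, ∑ t, Jt j t * sl t)
      ∧ (∀ t, 0 ≤ sl t) ∧ (∀ j t, 0 ≤ Jt j t) := by
  have hsup := tagged_supersolution hW hp0 hp hθ hacc hPoff hPin hPdiag hPout hPstay hK hNC hpres hM hrn hrs hΛn hΛs
  have hP0 := tagged_nonneg hW hacc hPoff hPin hPdiag hPout hPstay hK hNC
  have hJ00 : ∀ j t, 0 ≤ Jt j t :=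
    tail_iterate_nonneg (K := P) (κ := fun t => if t = some z then (1 : ℝ) else 0) hP0 (fun t => by positivity) hJ0 hJS
  refine ⟨?_, fun t => by rw [hsl]; linarith [hsup t], hJ00⟩
  have h := ledger_cumulative_eq hsl hJS n
  have h0 : ∑ t, Jt 0 t * Λ t = 0 := by
    refine sum_eq_zero fun t _ => ?_
    rw [hJ0]; rcases t with _ | v
    · simp
    · simp [hΛs]
  have hn : ∑ t, Jt n t * Λ t = -(1 - θ s) * Jt n none := by
    rw [tagged_sum_option, hΛn]; simp [hΛs]; ring
  have hrew : ∀ j, ∑ t, Jt (j + 1) t * r t = (K + M) * Jt (j + 1) none - (∑ v, Jt (j + 1) (some v) * (1 - θ v) + Jt (j + 1) none * (1 - θ s)) := by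
    intro j
    rw [tagged_sum_option, hrn]; simp only [hrs]
    have e : ∑ v, Jt (j + 1) (some v) * -(1 - θ v) = -∑ v, Jt (j + 1) (some v) * (1 - θ v) := by rw [← sum_neg_distrib]; exact sum_congr rfl fun v _ => by ring
    rw [e]; ring
  rw [h0, hn] at h
  calc ∑ j ∈ range n, ((K + M) * Jt (j + 1) none - (∑ v, Jt (j + 1) (some v) * (1 - θ v) + Jt (j + 1) none * (1 - θ s)))
      = ∑ j ∈ range n, ∑ t, Jt (j + 1) t * r t := sum_congr rfl fun j _ => (hrew j).symm
    _ = _ := by rw [h]; ring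

/-- **`s1 = (1−σ)slack(z) + σE_ũ[slack] + (1−σ)(1−θ_s)ũ(★) ≥ (1−σ)[slack(z) + σ⟨P(z,·),slack⟩]`** for the tail resolvent `ũ = (1−σ)P(z,·) + σũP`. [ours] -/
theorem ledger_certX_tail (hW : ∀ v, 0 < W v) (hp0 : 0 ≤ p) (hp : ∀ v, p * W v ≤ 1) (hθ : ∀ v, θ v = 1 / (1 + p * W v))
    (hacc : ∀ h v, acc h v = min 1 (W h / W v))
    (hPoff : ∀ h v, h ≠ v → P (some h) (some v) = if NC h = 0 then 0 else (NC v : ℝ) / K * acc h v)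
    (hPin : ∀ h, P (some h) none = if NC h = 0 then 0 else acc h s / K)
    (hPdiag : ∀ h, P (some h) (some h) = 1 - (∑ v ∈ univ.erase h, P (some h) (some v) + P (some h) none))
    (hPout : ∀ v, P none (some v) = (NC v : ℝ) / K * acc s v) (hPstay : P none none = 1 - ∑ v, P none (some v))
    (hK : 1 ≤ K) (hNC : ∑ v, NC v = K) (hpres : ∀ v, NC v ≠ 0) {M : ℝ} (hM : M = ∑ v, θ v * (NC v : ℝ) + θ s)
    {r Λ sl : Option S → ℝ} (hrn : r none = (K + M) - (1 - θ s)) (hrs : ∀ v, r (some v) = -(1 - θ v))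
    (hΛn : Λ none = -(1 - θ s)) (hΛs : ∀ v, Λ (some v) = 0) (hsl : ∀ t, sl t = ∑ t', P t t' * (r t' + Λ t') - Λ t)
    {σ : ℝ} (hσ0 : 0 ≤ σ) (hσ1 : σ < 1) {z : S} {ut : Option S → ℝ} (hut : ∀ t, ut t = (1 - σ) * P (some z) t + σ * ∑ t', ut t' * P t' t) :
    ((K + M) * ut none - (∑ v, ut (some v) * (1 - θ v) + ut none * (1 - θ s))
        = (1 - σ) * sl (some z) + σ * ∑ t, ut t * sl t + (1 - σ) * (1 - θ s) * ut none)
      ∧ (1 - σ) * (sl (some z) + σ * ∑ t, P (some z) t * sl t)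
          ≤ (K + M) * ut none - (∑ v, ut (some v) * (1 - θ v) + ut none * (1 - θ s)) := by
  have hsup := tagged_supersolution hW hp0 hp hθ hacc hPoff hPin hPdiag hPout hPstay hK hNC hpres hM hrn hrs hΛn hΛs
  have hP0 := tagged_nonneg hW hacc hPoff hPin hPdiag hPout hPstay hK hNC
  have hP1 := tagged_rowsum (P := P) hPdiag hPstay
  have hut0 : ∀ t, 0 ≤ ut t := geomResolvent_nonneg hP0 hP1 hσ0 hσ1 (ν := fun t => P (some z) t) (fun t => hP0 _ _) hut
  have hsl0 : ∀ t, 0 ≤ sl t := fun t => by rw [hsl]; linarith [hsup t]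
  have h := ledger_tail_eq hsl hut
  have hΛz : Λ (some z) = 0 := hΛs z
  have hEΛ : ∑ t, ut t * Λ t = -(1 - θ s) * ut none := by rw [tagged_sum_option, hΛn]; simp [hΛs]; ring
  have hEr : ∑ t, ut t * r t = (K + M) * ut none - (∑ v, ut (some v) * (1 - θ v) + ut none * (1 - θ s)) := by
    rw [tagged_sum_option, hrn]; simp only [hrs]
    have e : ∑ v, ut (some v) * -(1 - θ v) = -∑ v, ut (some v) * (1 - θ v) := by rw [← sum_neg_distrib]; exact sum_congr rfl fun v _ => by ring
    rw [e]; ring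
  rw [hΛz, hEΛ, hEr] at h
  have hge := ledger_tail_ge hσ0 hP0 hut0 hsl0 hut
  have hθs := (theta_mem hW hp0 hp hθ s).2
  refine ⟨by rw [h]; ring, ?_⟩
  rw [h]
  have : 0 ≤ (1 - σ) * (1 - θ s) * ut none := mul_nonneg (mul_nonneg (by linarith) (by linarith)) (hut0 none)
  nlinarith [mul_le_mul_of_nonneg_left hge hσ0]

end LedgerCert

end Summit.Ventures.LatticeQCDFlow.Scaling
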